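import Mathlib
import HarnessLib
import HarnessLib.Audit
import Summits.Parity.Statement
import Summits.Parity.GeneralizedHardyLittlewood.Theorems.LeeYangFibresAssemblyClose
import HarnessLib.Audit.Status.Attr

/-!
Route: DicksonFibration

DORMANT since 2026-08-24T18:39:21Z (reconciler: no traction for 7 d (last activity item-evidence-added at 2026-08-17T18:32:04Z); parked, not closed — `ledger route dormant route-Parity-DicksonFibration --off` to reactivate) — unstaffed, not closed; items shared with open routes are served there. `ledger route dormant <id> --off` reactivates.

# Route DicksonFibration — GHL is its own d = 1 case: a CONDITIONAL BRIDGE on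
Dickson–Hardy–Littlewood (DimOne) through the provable fibration lemma

CONDITIONAL BRIDGE on DimOne (this route's item stmt-Parity-0819 = GreenTao2010 Conj. 1.2 restricted
to d = 1: the Dickson–Hardy–Littlewood prime k-tuples conjecture with von Mangoldt weights, for
every t ≥ 1, uniform over coefficients Σ|a_i| ≤ L, shifts |b_i| ≤ L·N and convex K ⊆ [−N, N];
Dickson1904; GreenTao2010 §1, arXiv:math/0606088 p. 5: "the d = 1, t > 1 case … seems to be
extremely difficult"). It suffices to show X = DimOne: for every t ≥ 1 and L, uniformly over
non-degenerate systems Ψ = (a_1 n + b_1, …, a_t n + b_t) with ‖Ψ‖_N ≤ L and over convex K ⊆ [−N, N],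
Σ_{n ∈ K ∩ ℤ} Π_i Λ(a_i n + b_i) = β_∞ Π_p β_p + o_{t,L}(N). GHL → DimOne is one line (d = 1), so X
loses nothing; the route's own mathematical content is the bridge, the FIBRATION LEMMA `Assembly :
DimOne → GeneralizedHardyLittlewood` (GreenTao2010 §1, arXiv p. 5: "a d-parameter version … would
follow easily by holding d − 1 of the variables fixed and summing in the remaining one" — no printed
proof anywhere), PROVABLE NOW from proved in-tree facts and sizable in Lean (shear normalisation,
convex fibres, one-parameter CRT/Gallagher averaging of the fibre singular products UNIFORM in
shifts ≤ C·L·N, lattice points of convex bodies). The deciding theorem is pure logic: `closes :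
DimOne → FibreSingularProduct → PairsDimOne → Assembly → GeneralizedHardyLittlewood := fun hX _ _ hA
=> hA hX` (glue.lean, lean check rc 0, conclusion the sub-problem Statement by name). Every sibling
GHL route that reaches d = 1 closes the sub-problem through this lemma: HyperbolicConstellations and
PrimeDeterminantCells already carry DimOne as their target and this Assembly as their support item
FibrationLemma (shared items stmt-Parity-0819 / stmt-Parity-0822).
Lean: ∀ (t L : ℕ), 1 ≤ t → ∀ ε : ℝ, 0 < ε → ∃ N₀ : ℕ, ∀ N : ℕ, N₀ ≤ N → ∀ Ψ : Fin t →
Literature.NumberTheory.Sieve.AffLinForm 1, Literature.NumberTheory.Sieve.IsNondegenerateSystem Ψ →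
Literature.NumberTheory.Sieve.affLinSize Ψ N ≤ L → ∀ K : Set (Fin 1 → ℝ), Convex ℝ K → K ⊆
Literature.NumberTheory.Sieve.realBox 1 N → |Literature.NumberTheory.Sieve.vonMangoldtSum Ψ K N -
Literature.NumberTheory.Sieve.archFactor Ψ K * Literature.NumberTheory.Sieve.singularProduct Ψ| ≤ ε
* (N : ℝ)

UNDER FLOOR: fewer than 2 cruxes remain after retriage (legacy route; D-0019).

Rationale: WHY THIS LINE. Structural and load-bearing for the whole sub-problem:
Literature.NumberTheory.Sieve.GeneralizedHardyLittlewood quantifies over every dimension d, every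
convex K ⊆ [−N,N]^d and every non-degenerate system of size ≤ L, but all of its OPEN content sits at
d = 1 — every infinite-complexity system has two affinely related forms (GreenTao2010 §1, after Def.
1.5: the binary case "in which two or more of the forms are affinely related"), and conversely GHL →
DimOne is the specialisation d = 1. Fibring ℤ^d over ℤ^{d−1} after a unimodular shear that makes
every linear part non-zero on e₁ turns a d-dimensional system at scale N into (2CN+1)^{d−1}
one-dimensional systems with the SAME coefficients a_i = ψ̇_i(e₁) and shifts b_i(w) of size ≤ C·L·N
— exactly the uniformity in the constant terms that Conj. 1.2 builds into ‖Ψ‖_N ≤ L — so DimOne on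
each fibre plus an averaging lemma for the fibre main terms gives GHL (GreenTao2010 §1,
arXiv:math/0606088 p. 5, stated without proof: "would follow easily by holding d − 1 of the
variables fixed and summing in the remaining one"). The averaging lemma is a weighted one-parameter
instance of singular-series averaging (Gallagher1976 eq. (3), in tree and proved as
Literature.NumberTheory.Sieve.Gallagher.tendsto_sum_singularSeries_div_pow; FriedlanderGoldston1995;
Kowalski2011 Prop. 2.1) made UNIFORM in shifts ≤ C·L·N: β_p(Ψ) = E_{w mod p} β_p(Ψ_w) is an identity
(definition of localFactor + Fin.cons split), the head Π_{p ≤ z} is exact by CRT (z ~ (1/4) log N,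
primorial Q ≤ N^{1/4+o(1)} ≪ N: lattice points of the convex body K ∩ Ψ⁻¹(ℝ₊ᵗ) in the residue
classes of the fibred coordinate mod Q, GT App. A), pairs with parallel linear parts contribute a
w-INDEPENDENT factor that is pulled out exactly, and the remaining tail is Π_{p > z}(1 + η_p(w))
with 0 ≤ η_p(w) ≤ t/(p − t), η_p(w) = 0 unless p | D''(w) (the non-parallel part of Π_{i<j}(a_i
b_j(w) − a_j b_i(w))), P_w(p | D_ij(w)) ≤ 1/p + 1/(2N+1), whence E_w Σ_{p > z, p | D''(w)} t/p ≪
t³/z + t log log N/N and an L¹ deviation ≪ (log log N)^{t²+t}/z → 0 (planner evidence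
ASSEMBLY_SKETCH.md on stmt-Parity-0822; FibreSingularProduct is the frozen-constants warm-up,
numerically confirmed by refuters on 3 systems). Inputs, all in tree and PROVED:
Literature.NumberTheory.Sieve.tendsto_singularProductPartial_holds (GT Lemma 1.3: singularProduct is
a genuine limit for non-degenerate systems),
Literature.NumberTheory.Sieve.GreenTao2010_latticePointsConvexBody_holds (GT App. A: #(K ∩ ℤ^d) =
vol K + O(N^{d−1})), Literature.NumberTheory.Sieve.Gallagher.tendsto_sum_singularSeries_div_pow,
Mathlib's MvPolynomial.schwartz_zippel_totalDegree or a direct count for the shear (t hyperplanes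
miss a point of {0,…,t}^{d−1}), MeasureTheory.volume_preserving_piFinSuccAbove (Mathlib) for the
fibre decomposition of β_∞. NEEDS-FACT: NONE — no decl of the route uses an unproved Literature
fact; the 5 unproved facts of the import cone (GeneralizedHardyLittlewood = the target, reached only
as the Assembly's conclusion; GreenTaoZiegler2012_finiteComplexity, GeneralizedHardyLittlewoodCount,
BatemanHornConjecture, HardyLittlewoodConjE, referenced by no item) ride in on the gate-written
`import Summits.Parity.Statement`, route imports = [] (0 droppable); the elaborated cone of the
rendered file is 22 project constants, 0 unproved outside the statement. Area imported: none new
(lattice-point geometry of convex bodies, CRT); the catalogue (spectral, probabilistic, motivic,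
physical, model-theoretic) is for the sibling routes — this route exists so that their mechanisms
need only reach d = 1, and two of them (HyperbolicConstellations, PrimeDeterminantCells) already end
in DimOne + this Assembly (shared items stmt-Parity-0819 / 0822).
RANKED CRUXES. One crux — the declared bridge hypothesis — which is why the route is filed as a
CONDITIONAL BRIDGE (D-0019 floor waived) rather than padded with invented cruxes (four seats concur:
rev-1 retriage, rev-2 cone repair, rbadge g2 rev 3–5, rbadge g3 rev 6; no honest second crux exists
— PairsDimOne is the t = 2 special case and is implied even by DimOne restricted to t ≥ 3 (sum out a
free third form n + m: β_p of (ψ₁(n), ψ₂(n), n + m) is β_p(ψ₁, ψ₂) exactly), a near-shift/far-shift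
split of DimOne has no glue (mixed systems (n, n + 2, M − n) lie in neither half), and the Assembly
passes no crux test). The ledger flag conditional_bridge is at-open only and conditional_on must
name an EXISTING constant (the gate renders `attribute [route_premise] _root_.<conditional_on>`
before the item defs) — hence the definition request below.
#2 DimOne (crux, = X, shared as the TARGET of HyperbolicConstellations and PrimeDeterminantCells) —
d = 1 GHL for all t ≥ 1, uniform in shifts ≤ L·N and convex K ⊆ [−N,N] (why it might fail as a
target of proof: open for every t ≥ 2 — twins, Sophie Germain, Goldbach uniformly in the shift;
Selberg's parity barrier blocks every sieve derivation; the SHIFT-UNIFORM pair asymptotic forces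
quantitative Siegel-zero repulsion, MatomakiMerikoski2023 Thm 1.3 / GoldstonSuriajaya2021 Thm 2;
Green–Tao–Ziegler is vacuous at d = 1, t ≥ 2 by
Literature.Barriers.Parity.not_isFiniteComplexitySystem_dimOne_of_two_le) [GreenTao2010 Conj. 1.2;
Dickson1904].
#1 Assembly (assembly; shared as FibrationLemma) — DimOne → GeneralizedHardyLittlewood, PROVABLE
NOW, est. XL in Lean. Proof plan (induct on d, fibring ONE coordinate at a time so that every
average is one-parameter and every weight unimodal): (i) shear n₁ ↦ n₁, n_j ↦ n_j + k_j n₁, k ∈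
{0,…,t}^{d−1} with ψ̇_i(e₁ + Σ_j k_j e_j) ≠ 0 for all i (a union of t hyperplanes misses a grid
point), unimodular, so vonMangoldtSum, archFactor and singularProduct are invariant, ‖Ψ∘A‖_{CN} ≤
C(d,t)·L and A⁻¹K ⊆ [−CN, CN]^d; (ii) fibres K_w (w ∈ ℤ, |w| ≤ CN, the last coordinate) are convex,
fibre systems have dimension d − 1 ≥ 1 with every linear part non-zero (it keeps the
e₁-coefficient), shifts ≤ C·L·N, and are non-degenerate except for ≤ t² values of w (two forms are
proportional on the fibre over w iff their restricted linear parts are parallel and one affine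
equation in w holds; were that equation trivial the pair would be proportional globally), each bad
fibre costing ≤ (2CN+1)^{d−1} log^t(2CLN) = o(N^d) in total; (iii) the lower-dimensional statement
on every good fibre with ε' = ε/(4(3C)^d) — N₀ is uniform in w because it depends on (t, L', ε')
only; (iv) main terms Σ_w β_∞(Ψ_w, K_w)·𝔖(Ψ_w) = β_∞(Ψ, K)·𝔖(Ψ) + o(N^d) by the uniform averaging
lemma with the weight w ↦ β_∞(Ψ_w, K_w) ∈ [0, (2CN)^{d−1}]: replace each fibre volume by its
lattice-point count (GT App. A in dimension d − 1, O(N^{d−2}) per fibre), so that the head average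
becomes the count of lattice points of the convex body K⁺ = A⁻¹K ∩ Ψ⁻¹(ℝ₊ᵗ) in the classes n_d ≡ u
(mod Q), each equal to vol(K⁺)/Q + O(N^{d−1}) by GT App. A in dimension d applied to the affine
image n_d ↦ (n_d − u)/Q, and vol(K⁺) = β_∞; no Brunn–Minkowski or unimodality is needed, and the L¹
tail deviation only uses sup of the weight.
SUPPORT. FibreSingularProduct (stmt-Parity-0820; d = 2, frozen constants: (2N+1)⁻¹ Σ_{|w| ≤ N}
𝔖(Ψ_w) → 𝔖(Ψ); provable, takes (h : tendsto_singularProductPartial) in practice via the proved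
_holds) and PairsDimOne (stmt-Parity-0821; the t = 2 slice of DimOne, `fun h L ε hε => h 2 L (by
norm_num) ε hε`) — unranked for staffing; both are carried unused by `closes`.
TWO-LAYER PLAN. Foreseen glued split of Assembly (k = 3, filed only when a prover asks for it):
ShearNormalisation (every non-degenerate system is SL_d(ℤ)-equivalent, with controlled size, to one
whose linear parts are all non-zero on e₁) → UniformFibreAveraging (the weighted one-parameter
average of fibre singular products, uniform over systems of size ≤ L at scale N) → FibrationStep
(GHL in dimension d and UniformFibreAveraging give GHL in dimension d + 1) → Assembly by induction
from DimOne. Helper lemmas below that ride with `--supports stmt-Parity-0822`.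
KILL CRITERIA. Not refutable without refuting GHL itself (GHL → DimOne and GHL → Assembly are one
line each), so no refutation closes the route; a proof of ¬DimOne would decide the summit negatively
through any route. The bridge is RE-TYPED (a new support item + new glue; this Assembly stays as
filed) if a refuter exhibits a non-degenerate system whose weighted fibre average of singular
products does not converge to 𝔖(Ψ) uniformly in shifts ≤ C·L·N — i.e. ¬(uniform
FibreSingularProduct): the fibration must then average the full fibre ERROR instead of fibre main
terms. The route becomes moot (close `superseded`) once Assembly is proved and DimOne is carried by
the sibling routes, or if the operator re-bases the sub-problem Statement on d = 1.
NOT DECOMPOSED YET. The three-way split of Assembly above; the explicit constant C(d,t) of the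
shear; the counting form (Conj. 1.4) via
Literature.NumberTheory.Sieve.generalizedHardyLittlewood_count_of_vonMangoldt (not part of this
route); the passage from fixed-shift Hardy–Littlewood statements
(Literature.NumberTheory.Sieve.HardyLittlewoodConjE-type) to the shift-uniform DimOne, which is NOT
available (uniformity in b is genuine content, cf. Goldbach n, M − n inside PairsDimOne) — routes
proving fixed-shift pair asymptotics need their own residual item (e.g.
RoughSemiprimeRigidity.PairsToGHL), not this bridge.
CHEAPEST FALSIFIER. For the bridge: the shifted-window Gallagher average behind uniform
FibreSingularProduct — Ψ = (n₁, n₁ + n₂ + M) with M = 510510 (primorial; ‖Ψ‖_N ≈ 54 at N = 10⁴, so L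
= 55): check Σ_{|w| ≤ N} ℓ(w)·𝔖(w + M) against 𝔖(Ψ)·Σ_{|w| ≤ N} ℓ(w) with 𝔖(Ψ) = 1 (β_p(Ψ) = 1 for
every p since n₂ is free) for the triangular weight ℓ(w) = N − |w| (a few seconds of exact rational
arithmetic on 𝔖(h) = 2C₂ Π_{p | h, p > 2}(p−1)/(p−2)); a relative discrepancy not decaying like
N^{−1/2+o(1)} kills the uniform averaging step (refuters' frozen-constant runs on 3 systems already
agree to 0.4 % at N = 400). For DimOne there is no finite falsifier short of refuting GHL; its
cheapest STRESS test is logical: shift-uniform PairsDimOne + an exceptional zero at a modulus q ≤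
L·N contradicts MatomakiMerikoski2023 Thm 1.3, so DimOne is at least a quantitative no-Siegel-zero
theorem.
DEFINITION REQUESTS. defn-GeneralizedHardyLittlewoodDimOne (filed 2026-08-15 by rbadge g3, --for
stmt-Parity-0819): register the d = 1 case of Green–Tao Conj. 1.2 as a Literature open statement
`@[conjecture] def Literature.NumberTheory.Sieve.GeneralizedHardyLittlewoodDimOne : Prop :=
<verbatim the Lean text of DimOne>` ([status: open], no `_holds`; pattern of
Literature.NumberTheory.Sieve.HardyLittlewoodTuples, which is the fixed-shift counting form and
strictly weaker in uniformity) with the proved one-liner `GeneralizedHardyLittlewood.dimOne :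
GeneralizedHardyLittlewood → GeneralizedHardyLittlewoodDimOne`. Then `DimOne ↔
GeneralizedHardyLittlewoodDimOne` is `Iff.rfl`, the three routes carrying DimOne (this one,
HyperbolicConstellations, PrimeDeterminantCells) share a citable name for their target, and this
route's CONDITIONAL flag can be set with conditional_on = that decl (operator; plus `imports` if it
lands in a new module).

Novelty: NOVELTY (retriage draft; searched before claiming: lit search/ --hybrid "singular series averages",
"Dickson conjecture ... several variables", lit frontier Parity --since 2020, lit bridges Parity
--cross any, lean search).
Nearest prior art: (1) GreenTao2010 (arXiv:math/0606088), p.5 of the arXiv text: "the case d = 1 of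
Conjecture [1.2] – then a d-parameter version ... would follow easily by holding d-1 of the
variables fixed and summing in the remaining one" — the route's Assembly DimOne → GHL is exactly
this printed remark (no printed proof; grep of the paper finds no other occurrence). (2)
arXiv:0906.3850 (Notes on Dickson's Conjecture, 2009): formulates a qualitative multivariable
Dickson conjecture for affine-linear systems on N^k via CRT, without reducing the asymptotic to one
variable. (3) The fibre-averaging of singular products (former crux FibreSingularProduct, now
support) is a one-parameter instance of singular-series averaging: Gallagher1976 eq. (3) (in tree,
proved: Literature.NumberTheory.Sieve.Gallagher.tendsto_sum_singularSeries_div_pow),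
FriedlanderGoldston1995 (doi:10.1215/ijm/1255986635, singular series averages), Kowalski2011
(doi:10.4064/aa148-2-4, Prop. 2.1: averages of convergent Euler products over parametrised
families). (4) The other inputs are in tree:
Literature.NumberTheory.Sieve.tendsto_singularProductPartial_holds (GT Lemma 1.3) and
Literature.NumberTheory.Sieve.GreenTao2010_latticePointsConvexBody_holds (GT App. A).
Delta: none in mechanism —  [refs: 10.1215/ijm/1255986635, 10.4064/aa148-2-4, math/0606088, 0906.3850, doi:10.1215/ijm/1255986635, doi:10.4064/aa148-2-4, GreenTao2010, Gallagher1976, FriedlanderGoldston1995, Kowalski2011]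

Barriers (technique_class: fibration-reduction singular-series-averaging lattice-points): BARRIERS (retriage draft). technique_class: fibration-reduction singular-series-averaging
lattice-points
The route's own mechanism (fibring ℤ^d over ℤ^{d-1}, CRT/Gallagher averaging of fibre singular
products, convex-body lattice-point counting) is an implication between two slices of the same
conjecture and meets no catalogued barrier; every binary barrier applies UNEVADED to the single crux
DimOne, into which the route deliberately relocates the whole difficulty ("it does not evade; the
bet is that d = 1 is the right common target for the sibling routes"):
- Literature.Barriers.Parity.SelbergParityBarrier — no Type-I/sieve derivation of the d = 1
prime-tuple asymptotic (any level ν < 1); applies to DimOne and PairsDimOne; not evaded.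
- Literature.Barriers.Parity.CriticalDensityHalf — via
Literature.Barriers.Parity.not_isFiniteComplexitySystem_dimOne_of_two_le every d = 1 system with t ≥
2 has infinite complexity, so Literature.NumberTheory.Sieve.GreenTaoZiegler2012_finiteComplexity is
vacuous on DimOne (only its t = 1 slice, PNT in APs, is covered); not evaded.
- Literature.Barriers.Parity.TrueComplexityBinary — no fixed-order Gowers norm controls the binary
averages inside DimOne (t = 2); not evaded.
- Literature.Barriers.Parity.CircleMethodBinaryBarrier — minor-arc L² dominance blocks size-only
circle-method proofs of PairsDimOne; not evaded.
- Literature.Barriers.Parity.SiegelZeroPrimePairBarrier — bears on DimOne AS TYPED: it is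
SHIFT-UNIFORM (|b_i| ≤ L·N), and shift-un

History (route lifecycle, newest last):
- 2026-08-17T11:56:10Z · skeleton.hides-summit: stub_twoFlatFactors (stmt-Parity-0819) ⟷ summit (accepted theorem in Summits/Parity/GeneralizedHardyLittlewood/Theorems/DicksonFibrationDimOneEquivalence.lean) (prover-line-stmt-Parity-0819-c2-0)
- 2026-08-24T18:39:21Z · DORMANT — reconciler: no traction for 7 d (last activity item-evidence-added at 2026-08-17T18:32:04Z); parked, not closed — `ledger route dormant route-Parity-DicksonFibr (operator:999:3129925)

sub-problem: GeneralizedHardyLittlewood · status: dormant · opened planner-plan-Parity-GeneralizedHardyLittlewood-0 2026-08-13T19:14:21Z · rev 7 · ledger route-Parity-DicksonFibration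
GENERATED by the gate from the ledger (D-0016/17). Provers cite these decls: `theorem foo : Summit.Parity.GeneralizedHardyLittlewood.Theses.DicksonFibration.<Decl> := …` in Summits/Parity/GeneralizedHardyLittlewood/Theorems/<Name>.lean.
-/

namespace Summit.Parity.GeneralizedHardyLittlewood.Theses.DicksonFibration

open scoped BigOperators Topology Manifold Classical MeasureTheory ProbabilityTheory Matrix InnerProductSpace ComplexConjugate ContinuousMap
open Filter Set Function TopologicalSpace MeasureTheory

attribute [summit_statement] _root_.GeneralizedHardyLittlewood

/-- item stmt-Parity-0819 · crux · rank 2 · open · by planner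
why it might fail: Open binary HL for all t≥2 (twins, k-tuples) AND shift-uniform (|b_i|≤LN): under a Siegel zero mod q, ΣΛ(n)Λ(n+q)≈2𝔖_q·X (Matomäki–Merikoski Thm 1.3), so any proof must repel exceptional zeros; parity blocks sieves; GTZ is vacuous at d=1 (infinite complexity).
sources: GreenTao2010, Conj. 1.2 and p.5 (arXiv:math/0606088): 'the d=1, t>1 case ... seems to be extremely difficult', MatomakiMerikoski2023, Thm 1.3 / GoldstonSuriajaya2021, Thm 2 (Literature.Barriers.Parity.SiegelZeroPrimePairBarrier), Literature.Barriers.Parity.SelbergParityBarrier (Ford2004 §1; Selberg1952Limitations), Literature.Barriers.Parity.not_isFiniteComplexitySystem_dimOne_of_two_le (Literature/Barriers/Parity/CriticalDensityHalf.lean), Literature.Barriers.Parity.TrueComplexityBinary (GowersWolf2010TrueComplexity), Literature.Barriers.Parity.CircleMethodBinaryBarrier (Tao2012CircleMethodBlog §1)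
[crux] The d = 1 case of Literature.NumberTheory.Sieve.GeneralizedHardyLittlewood
(Dickson–Hardy–Littlewood, Λ-weighted): for all t ≥ 1, L, uniformly over non-degenerate systems of t
forms a_i n + b_i with ‖Ψ‖_N ≤ L (so |b_i| ≤ L N) and intervals K ⊆ [-N, N]: |∑_{n ∈ K} ∏ Λ(a_i n +
b_i) − β_∞ ∏_p β_p| ≤ ε N for N ≥ N₀(t, L, ε). Open (contains twin primes, Sophie Germain, Goldbach
asymptotics uniformly in the shift). GHL → DimOne is immediate; the route's content is the converse
(Assembly). [GreenTao2010, Conj. 1.2, p. 6] -/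
@[route_item "route-Parity-DicksonFibration", crux]
def DimOne : Prop :=
  ∀ (t L : ℕ), 1 ≤ t → ∀ ε : ℝ, 0 < ε → ∃ N₀ : ℕ, ∀ N : ℕ, N₀ ≤ N → ∀ Ψ : Fin t → Literature.NumberTheory.Sieve.AffLinForm 1, Literature.NumberTheory.Sieve.IsNondegenerateSystem Ψ → Literature.NumberTheory.Sieve.affLinSize Ψ N ≤ L → ∀ K : Set (Fin 1 → ℝ), Convex ℝ K → K ⊆ Literature.NumberTheory.Sieve.realBox 1 N → |Literature.NumberTheory.Sieve.vonMangoldtSum Ψ K N - Literature.NumberTheory.Sieve.archFactor Ψ K * Literature.NumberTheory.Sieve.singularProduct Ψ| ≤ ε * (N : ℝ)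

/-- item stmt-Parity-0820 · support · rank 3 · open · by planner
[crux] PROVABLE (arithmetic half of the fibration lemma), d = 2 instance: for a non-degenerate
system Ψ on ℤ² with (Ψ i).coeff 0 ≠ 0 for all i, the fibre systems Ψ_w : m ↦ ψ_i(m, w) = c₀ m + (c₁
w + const) satisfy (1/(2N+1)) ∑_{|w| ≤ N} ∏_p β_p(Ψ_w) → ∏_p β_p(Ψ). Proof sketch: β_p(Ψ) = 𝔼_{w mod
p} β_p(Ψ_w) by definition of localFactor, so truncated products average exactly by CRT +
equidistribution of w mod ∏_{p ≤ P} p; tail p > P: β_p(Ψ_w) = 1 + O_t(p⁻²) unless p divides D(w) =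
∏_{i<j}(a_i b_j(w) − a_j b_i(w)) ≠ 0 (degenerate w, at most t² of them, contribute O(1)/(2N+1)), and
∑_w ∑_{p | D(w), p > P} 1/p ≪ N/P·log. [GreenTao2010, Lemma 1.3 and p. 67] -/
@[route_item "route-Parity-DicksonFibration", crux]
def FibreSingularProduct : Prop :=
  ∀ (t : ℕ) (Ψ : Fin t → Literature.NumberTheory.Sieve.AffLinForm 2), Literature.NumberTheory.Sieve.IsNondegenerateSystem Ψ → (∀ i, (Ψ i).coeff 0 ≠ 0) → Filter.Tendsto (fun N : ℕ => (∑ w ∈ Finset.Icc (-(N : ℤ)) N, Literature.NumberTheory.Sieve.singularProduct (fun i => (⟨![(Ψ i).coeff 0], (Ψ i).coeff 1 * w + (Ψ i).const⟩ : Literature.NumberTheory.Sieve.AffLinForm 1))) / (2 * N + 1)) Filter.atTop (nhds (Literature.NumberTheory.Sieve.singularProduct Ψ))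

/-- item stmt-Parity-0821 · support · rank 4 · open · by planner
[support] The t = 2 instance of DimOne (first infinite-complexity case: pairs (a₁n+b₁, a₂n+b₂)
uniformly in |b_i| ≤ L N over intervals ⊆ [-N,N]; contains twin primes (n, n+2), Sophie Germain (n,
2n+1) and binary Goldbach (n, M−n), M ≤ L N). DimOne → PairsDimOne is `fun h L ε hε => h 2 L (by
norm_num) ε hε`. Open. [GreenTao2010, Example 1, p. 7] -/
@[route_item "route-Parity-DicksonFibration", crux]
def PairsDimOne : Prop :=
  ∀ L : ℕ, ∀ ε : ℝ, 0 < ε → ∃ N₀ : ℕ, ∀ N : ℕ, N₀ ≤ N → ∀ Ψ : Fin 2 → Literature.NumberTheory.Sieve.AffLinForm 1, Literature.NumberTheory.Sieve.IsNondegenerateSystem Ψ → Literature.NumberTheory.Sieve.affLinSize Ψ N ≤ L → ∀ K : Set (Fin 1 → ℝ), Convex ℝ K → K ⊆ Literature.NumberTheory.Sieve.realBox 1 N → |Literature.NumberTheory.Sieve.vonMangoldtSum Ψ K N - Literature.NumberTheory.Sieve.archFactor Ψ K * Literature.NumberTheory.Sieve.singularProduct Ψ| ≤ ε * (N : ℝ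)

/-- item stmt-Parity-0822 · assembly · rank 1 · closed · proved by Summit.Parity.GeneralizedHardyLittlewood.Theorems.leeYangFibres_fibrationLemma (prover) · by planner
[assembly] The fibration lemma DimOne → GeneralizedHardyLittlewood [GreenTao2010, p. 6: 'holding d −
1 of the variables fixed and summing in the remaining one']. PROVABLE but sizable: (i) unimodular
change of basis of ℤ^d making every linear part non-vanishing on e₁ (affLinSize and realBox change
by C(d,t,L): rescale N); (ii) fibres K_w = K ∩ (w + ℝe₁) are intervals ⊆ [-CN, CN], fibre systems
are d = 1 systems with constants ≤ C L N, non-degenerate off O_t(N^{d−2}) fibres (trivial bound N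
log^t N on those); (iii) DimOne on each good fibre with N₀ uniform in w; (iv) main terms ∑_w |K_w ∩
{Ψ_w > 0}|·∏_p β_p(Ψ_w) = β_∞ ∏_p β_p + o(N^d) via FibreSingularProduct-type averaging weighted by
fibre lengths [GreenTao2010, App. A]. -/
@[route_item "route-Parity-DicksonFibration", crux]
def Assembly : Prop :=
  DimOne → GeneralizedHardyLittlewood

/-- `Assembly` holds: proved by `Summit.Parity.GeneralizedHardyLittlewood.Theorems.leeYangFibres_fibrationLemma`. -/
theorem Assembly_holds : Assembly := _root_.Summit.Parity.GeneralizedHardyLittlewood.Theorems.leeYangFibres_fibrationLemma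

/-! D-0027 §2.1 — DECIDING THEOREM (planner-authored via `route open/edit --closes-file`; by planner-rbadge-Parity-DicksonFibration-84c5cbc2-g2-0 2026-08-15T16:19:22Z):
its hypotheses are this route's items and its conclusion the sub-problem Statement (glue_lint), and it elaborates with this file. -/

/-- D-0027 §2.1 deciding theorem of route DicksonFibration (CONDITIONAL BRIDGE on `DimOne`, the
`d = 1` case of Green–Tao Conj. 1.2 = Dickson–Hardy–Littlewood with von Mangoldt weights, uniform
in the shifts): the fibration lemma `Assembly : DimOne → GeneralizedHardyLittlewood` (provable:
shear normalisation, fibres of a convex body, Gallagher/CRT averaging of the fibre singular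
products) carries the `d = 1` conjecture to the sub-problem Statement. `FibreSingularProduct`
(frozen-constants warm-up of the averaging step) and `PairsDimOne` (the `t = 2` slice of `DimOne`)
are carried as hypotheses but not used. -/
@[closes "route-Parity-DicksonFibration"] theorem closes : DimOne → FibreSingularProduct → PairsDimOne → Assembly → GeneralizedHardyLittlewood :=
  fun hX _ _ hA => hA hX

end Summit.Parity.GeneralizedHardyLittlewood.Theses.DicksonFibration
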